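import Summits.QuantumFields.BalabanUV.Beta.EriceRemainderEnclosureHistoryAutonomyComparisonAgeCompositionNestedOldPair
import Summits.QuantumFields.BalabanUV.Beta.EriceRemainderEnclosureHistoryAutonomyComparisonAgeCompositionNestedYoungPairTails

/-!
# EriceRemainderEnclosureHistoryAutonomyComparisonAgeCompositionThreeAgesFromFortyFive — (E92g) route (N), first order: THE CENSUS THREE AGES `{1, k₂, k₃}` AT
# EVERY OLD RATIO FROM `k₂ ≥ 45` — `0 ≤ ε ≤ e` ALONG EVERY ADMISSIBLE FLOW, EVERY HORIZON, EVERY DAMPING OF THE SELF-CONSISTENT CLASS, WHATEVER THE TOTAL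
# LOAD, NO DISPLAYED MARGIN.  The ratio `(k₃+1)∕(k₂+1)` is covered by five typed regimes: `≤ 2` by (E92b)'s discharged wedge R1 (`p₀ = 0.8408`, needs
# `k₂ ≥ 44`); `[2, 4]`, `[4, 10]`, `[10, 36]` by (E92f)'s old-pair nested criterion (`p₀ = 0.707 ∕ 0.5623 ∕ 0.4082`, needs `k₂ ≥ 45`); `≥ 36` by the
# young-pair tails of (E92e) (`k₂ ≤ 229`) and by (E92c) `flow_nonneg_census_three_ages_old_middle` (`k₂ ≥ 230`).  README g83∕e92 §3: with (E90c)
# (`k₃ ≤ 56`) what is left of «three ages at every ratio» is the bounded set `2 ≤ k₂ ≤ 44`, `57 ≤ k₃ ≤ T(k₂)` (`T ≤ 1600`; the exact criteria of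
# (E92d)∕(E92f) with `p₀(k₂,k₃)` leave numerically the same `k₂ ≤ 44`)

Cell `pub-balaban`, β-function sub-cell, BINDER row D4 «RemainderConst leaves for Bałaban's split» (`HOME/BINDER-OWNERS.md`; owner lineage `b2b-balaban-beta-an4`;
this file by co-owner #2 lineage `b2b-balaban-beta-d4-p2`, generation 83), β-FLOW TEAM duty (1), FREEZE (0) honoured (def-free; nothing restated).

HONEST FRAMING (page 1, verbatim and binding).  *"Discharging BetaPertH makes Bałaban's UV stability UNCONDITIONAL — a real constructive-QFT result; it is
NOT the continuum limit and NOT the Clay problem."*  THIS FILE DISCHARGES NOTHING OF THE KIND.  Elementary real algebra ∕ real analysis about ABSTRACT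
functionals on a box ]0,γ]^ℕ with displayed floors, profiles and signs, and the FIRST-ORDER renewal objects of route (N) built from them — hypotheses of a
census, not facts; the form, signs, ages and moments of Bałaban's (1.22) limit functional are NOT PRINTED ([I] p. 298; GAPS G-t4-U2-1∕-2) and NOT asserted.
Row D4 class UNCHANGED (critical-path width 0; instance 0∕1; D4 DISCHARGE NO DATE).  HONEST DEPENDENCY: continuum YM on T⁴ ⇐ BetaPertH ∧ nine spine
estimates (0/9 proved); BetaPertH ⇐ (D1) ∧ (D4) ∧ CAP+tail; G-an2-4 gates asym, D1 and NE2/3/4.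

THE NUMBERS (README `HOME/b2b-balaban-beta-d4-p2/g83/e92/README.md` §2(f)).  R1: `0.8408⁴·2 ≤ 1`, `18.408 ≤ (1.8408 − 99∕70)·44 = 18.77`.  Bands
(`K_lo = 45`): `[2,4]`: `u_U = 0.1214`, check `0.0733 ≤ 0.0754`; `[4,10]`: `u_U = 0.1982`, `0.0680 ≤ 0.0688`; `[10,36]`: `u_U = 0.2972`, `0.0586 ≤ 0.0603`.
Tails from ratio `36`: `36·46 − 1 ≥ 1600`, `36·68 − 1 ≥ 1800`, `36·102 − 1 ≥ 3600`.  Uses (E92b) `flow_nonneg_three_ages_middle_old`, (E92f)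
`flow_nonneg_census_three_ages_old_pair`∕`old_pair_slack_le`∕`old_pair_check`, (E92e) `flow_nonneg_census_three_ages_tail_30_66`∕`_67_100`∕`_101_229`,
(E92c) `flow_nonneg_census_three_ages_old_middle` BY NAME.  NOT CLAIMED: `k₂ ≤ 44`; four or more ages; anything printed — NOT B12 Thm 2, NOT BetaPertH.

WHAT IS PROVED ([folklore]; 0 `def`, 0 sorry).  §1 `flow_nonneg_census_three_ages_ratio_le_two`, `flow_nonneg_census_three_ages_band_2_4`, `_band_4_10`,
`_band_10_36`.  §2 **`flow_nonneg_census_three_ages_from_fortyfive`** (`45 ≤ k₂ < k₃ < K`: every old age), **`flow_nonneg_census_three_ages_every_tail`**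
(`2 ≤ k₂ < k₃ < K`, `k₃ ≥ 1600`: every middle age; for `k₂ ≤ 13` by (E92b)'s R2 with `p₀ = 0.6147`).  The open set of the census three ages is thus inside
`2 ≤ k₂ ≤ 44`, `57 ≤ k₃ ≤ 1599`.
-/
noncomputable section
open Finset

namespace Summit.QuantumFields.BalabanUV.Beta.EriceRemainderEnclosureHistoryAutonomyComparisonAgeCompositionThreeAgesFromFortyFive

open Literature.MathematicalPhysics.QuantumFieldTheory.Balaban1983to89
open Literature.MathematicalPhysics.QuantumFieldTheory.Balaban1983to89.T4BetaStationary
open Literature.MathematicalPhysics.QuantumFieldTheory.Balaban1983to89.T4BetaFlowWellPosed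
open Summit.QuantumFields.BalabanUV.Beta.EriceRemainderEnclosureHistoryAutonomyComparisonAgeCompositionPairShares
  (flow_nonneg_three_ages_middle_old flow_nonneg_three_ages_young_pair)
open Summit.QuantumFields.BalabanUV.Beta.EriceRemainderEnclosureHistoryAutonomyComparisonAgeCompositionNestedMoments
  (flow_nonneg_census_three_ages_old_middle)
open Summit.QuantumFields.BalabanUV.Beta.EriceRemainderEnclosureHistoryAutonomyComparisonAgeCompositionNestedYoungPairTails
  (flow_nonneg_census_three_ages_tail_14_29 flow_nonneg_census_three_ages_tail_30_66 flow_nonneg_census_three_ages_tail_67_100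
  flow_nonneg_census_three_ages_tail_101_229)
open Summit.QuantumFields.BalabanUV.Beta.EriceRemainderEnclosureHistoryAutonomyComparisonAgeCompositionNestedOldPair
  (flow_nonneg_census_three_ages_old_pair old_pair_slack_le old_pair_check)

variable {B : (ℕ → ℝ) → ℝ} {γ b gIR : ℝ} {L : ℕ → ℝ} {K : ℕ} {h g : ℕ → ℝ}

/-! ## §1 The five regimes of the old ratio -/

/-- **RATIO AT MOST `2`: `k₃ + 1 ≤ 2(k₂+1)`, `k₂ ≥ 44` ⟹ THE END** ((E92b) `flow_nonneg_three_ages_middle_old` with `p₀ = 0.8408`). [folklore] -/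
theorem flow_nonneg_census_three_ages_ratio_le_two (hmono : ∀ u v : ℕ → ℝ, SeqBox γ u → SeqBox γ v → (∀ j, u j ≤ v j) → B u ≤ B v)
    (hL : ∀ k, 0 ≤ L k) (hb : 0 < b) (hlo : ∀ u, SeqBox γ u → b ≤ B u) (hdom : ∀ u, SeqBox γ u → ∑ k ∈ range K, L k * u k ≤ B u)
    (hh : SeqBox γ h) (hf : MemFlow B gIR h) (hg : ∀ t, 0 < g t ∧ g t ≤ 1)
    (hgF : ∀ t, 1 ≤ g t * (1 + ∑ k ∈ range K, L k * h (t + k) ^ 3 / 2))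
    {k₂ k₃ : ℕ} (hk2 : 44 ≤ k₂) (hk23 : k₂ < k₃) (hratio : k₃ + 1 ≤ 2 * (k₂ + 1)) (hk3K : k₃ < K)
    (hL3 : ∀ j, j < K → j ≠ 1 → j ≠ k₂ → j ≠ k₃ → L j = 0)
    {N : ℕ} {KL : ℕ → ℕ → ℕ → ℝ}
    (hKL : ∀ k n l, KL k n l = if 0 < k ∧ k < K ∧ l < k then L k * h (n + k) ^ 3 / 2 * ∏ t ∈ Ico (n + 1 + l) (n + k + 1), g t else 0)
    {KA : ℕ → ℕ → ℕ → ℝ} {RA : ℕ → (ℕ → ℝ) → ℕ → ℝ}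
    (hRA : ∀ i v m, RA i v m = ∑ l ∈ range K, KA i m l * v (m + 1 + l))
    (hKA : ∀ i m l, KA i m l = KL i m l + KA (i + 1) m l) (hKAtop : ∀ m l, KA K m l = 0)
    {e ε : ℕ → ℝ} (he0 : ∀ m, 0 ≤ e m) (hea : ∀ m, e (m + 1) ≤ e m)
    (hεt : ∀ m, N < m → ε m = 0) (hεrec : ∀ m, ε m = e m - RA 1 ε m) : ∀ m, 0 ≤ ε m ∧ ε m ≤ e m := by
  have hs99 : Real.sqrt 2 ≤ 99 / 70 := Real.sqrt_le_iff.mpr ⟨by norm_num, by norm_num⟩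
  have hk2r : (44 : ℝ) ≤ k₂ := by exact_mod_cast hk2
  have hr : (k₃ : ℝ) + 1 ≤ 2 * ((k₂ : ℝ) + 1) := by exact_mod_cast hratio
  refine flow_nonneg_three_ages_middle_old hmono hL hb hlo hdom hh hf hg hgF (by omega) hk23 hk3K hL3 (p₀ := 0.8408) (by norm_num)
    ?_ ?_ hKL hRA hKA hKAtop he0 hea hεt hεrec
  · have h2 : (0.8408 : ℝ) ^ 4 * 2 ≤ 1 := by norm_num
    have h1 : (0.8408 : ℝ) ^ 4 * ((k₃ : ℝ) + 1) ≤ (0.8408 : ℝ) ^ 4 * (2 * ((k₂ : ℝ) + 1)) := mul_le_mul_of_nonneg_left hr (by positivity)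
    have h3 : ((0.8408 : ℝ) ^ 4 * 2) * ((k₂ : ℝ) + 1) ≤ 1 * ((k₂ : ℝ) + 1) := mul_le_mul_of_nonneg_right h2 (by positivity)
    linarith
  · nlinarith [mul_nonneg (sub_nonneg.2 hs99) (sub_nonneg.2 hk2r)]

/-- **RATIO IN `[2, 4]`: `2(k₂+1) ≤ k₃`, `k₃ + 1 ≤ 4(k₂+1)`, `k₂ ≥ 45` ⟹ THE END** ((E92f) with `p₀ = 0.707`, `u_U = 0.1214`). [folklore] -/
theorem flow_nonneg_census_three_ages_band_2_4 (hmono : ∀ u v : ℕ → ℝ, SeqBox γ u → SeqBox γ v → (∀ j, u j ≤ v j) → B u ≤ B v)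
    (hL : ∀ k, 0 ≤ L k) (hb : 0 < b) (hlo : ∀ u, SeqBox γ u → b ≤ B u) (hdom : ∀ u, SeqBox γ u → ∑ k ∈ range K, L k * u k ≤ B u)
    (hh : SeqBox γ h) (hf : MemFlow B gIR h) (hg : ∀ t, 0 < g t ∧ g t ≤ 1)
    (hgF : ∀ t, 1 ≤ g t * (1 + ∑ k ∈ range K, L k * h (t + k) ^ 3 / 2))
    {k₂ k₃ : ℕ} (hk2 : 45 ≤ k₂) (hlo' : 2 * (k₂ + 1) ≤ k₃) (hhi : k₃ + 1 ≤ 4 * (k₂ + 1)) (hk3K : k₃ < K)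
    (hL3 : ∀ j, j < K → j ≠ 1 → j ≠ k₂ → j ≠ k₃ → L j = 0)
    {N : ℕ} {KL : ℕ → ℕ → ℕ → ℝ}
    (hKL : ∀ k n l, KL k n l = if 0 < k ∧ k < K ∧ l < k then L k * h (n + k) ^ 3 / 2 * ∏ t ∈ Ico (n + 1 + l) (n + k + 1), g t else 0)
    {KA : ℕ → ℕ → ℕ → ℝ} {RA : ℕ → (ℕ → ℝ) → ℕ → ℝ}
    (hRA : ∀ i v m, RA i v m = ∑ l ∈ range K, KA i m l * v (m + 1 + l))
    (hKA : ∀ i m l, KA i m l = KL i m l + KA (i + 1) m l) (hKAtop : ∀ m l, KA K m l = 0)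
    {e ε : ℕ → ℝ} (he0 : ∀ m, 0 ≤ e m) (hea : ∀ m, e (m + 1) ≤ e m)
    (hεt : ∀ m, N < m → ε m = 0) (hεrec : ∀ m, ε m = e m - RA 1 ε m) : ∀ m, 0 ≤ ε m ∧ ε m ≤ e m := by
  have hk2r : (45 : ℝ) ≤ k₂ := by exact_mod_cast hk2
  have hlor : 2 * ((k₂ : ℝ) + 1) ≤ k₃ := by exact_mod_cast hlo'
  have hhir : (k₃ : ℝ) + 1 ≤ 4 * ((k₂ : ℝ) + 1) := by exact_mod_cast hhi
  obtain ⟨hu0, hu⟩ := old_pair_slack_le (p₀ := 0.707) (uU := 0.1214) (by norm_num) (by norm_num) (by norm_num)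
  refine flow_nonneg_census_three_ages_old_pair hmono hL hb hlo hdom hh hf hg hgF (by omega) hlo' hk3K hL3 (p₀ := 0.707) (by norm_num)
    ?_ (old_pair_check hu0 hu (by norm_num) (by norm_num) (by norm_num) hk2r hlor (by norm_num)) hKL hRA hKA hKAtop he0 hea hεt hεrec
  have h2 : (0.707 : ℝ) ^ 4 * 4 ≤ 1 := by norm_num
  have h1 : (0.707 : ℝ) ^ 4 * ((k₃ : ℝ) + 1) ≤ (0.707 : ℝ) ^ 4 * (4 * ((k₂ : ℝ) + 1)) := mul_le_mul_of_nonneg_left hhir (by positivity)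
  have h3 : ((0.707 : ℝ) ^ 4 * 4) * ((k₂ : ℝ) + 1) ≤ 1 * ((k₂ : ℝ) + 1) := mul_le_mul_of_nonneg_right h2 (by positivity)
  linarith

/-- **RATIO IN `[4, 10]`: `4(k₂+1) ≤ k₃`, `k₃ + 1 ≤ 10(k₂+1)`, `k₂ ≥ 45` ⟹ THE END** ((E92f) with `p₀ = 0.5623`, `u_U = 0.1982`). [folklore] -/
theorem flow_nonneg_census_three_ages_band_4_10 (hmono : ∀ u v : ℕ → ℝ, SeqBox γ u → SeqBox γ v → (∀ j, u j ≤ v j) → B u ≤ B v)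
    (hL : ∀ k, 0 ≤ L k) (hb : 0 < b) (hlo : ∀ u, SeqBox γ u → b ≤ B u) (hdom : ∀ u, SeqBox γ u → ∑ k ∈ range K, L k * u k ≤ B u)
    (hh : SeqBox γ h) (hf : MemFlow B gIR h) (hg : ∀ t, 0 < g t ∧ g t ≤ 1)
    (hgF : ∀ t, 1 ≤ g t * (1 + ∑ k ∈ range K, L k * h (t + k) ^ 3 / 2))
    {k₂ k₃ : ℕ} (hk2 : 45 ≤ k₂) (hlo' : 4 * (k₂ + 1) ≤ k₃) (hhi : k₃ + 1 ≤ 10 * (k₂ + 1)) (hk3K : k₃ < K)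
    (hL3 : ∀ j, j < K → j ≠ 1 → j ≠ k₂ → j ≠ k₃ → L j = 0)
    {N : ℕ} {KL : ℕ → ℕ → ℕ → ℝ}
    (hKL : ∀ k n l, KL k n l = if 0 < k ∧ k < K ∧ l < k then L k * h (n + k) ^ 3 / 2 * ∏ t ∈ Ico (n + 1 + l) (n + k + 1), g t else 0)
    {KA : ℕ → ℕ → ℕ → ℝ} {RA : ℕ → (ℕ → ℝ) → ℕ → ℝ}
    (hRA : ∀ i v m, RA i v m = ∑ l ∈ range K, KA i m l * v (m + 1 + l))
    (hKA : ∀ i m l, KA i m l = KL i m l + KA (i + 1) m l) (hKAtop : ∀ m l, KA K m l = 0)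
    {e ε : ℕ → ℝ} (he0 : ∀ m, 0 ≤ e m) (hea : ∀ m, e (m + 1) ≤ e m)
    (hεt : ∀ m, N < m → ε m = 0) (hεrec : ∀ m, ε m = e m - RA 1 ε m) : ∀ m, 0 ≤ ε m ∧ ε m ≤ e m := by
  have hk2r : (45 : ℝ) ≤ k₂ := by exact_mod_cast hk2
  have hlor : 4 * ((k₂ : ℝ) + 1) ≤ k₃ := by exact_mod_cast hlo'
  have hhir : (k₃ : ℝ) + 1 ≤ 10 * ((k₂ : ℝ) + 1) := by exact_mod_cast hhi
  obtain ⟨hu0, hu⟩ := old_pair_slack_le (p₀ := 0.5623) (uU := 0.1982) (by norm_num) (by norm_num) (by norm_num)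
  refine flow_nonneg_census_three_ages_old_pair hmono hL hb hlo hdom hh hf hg hgF (by omega) (by omega) hk3K hL3 (p₀ := 0.5623) (by norm_num)
    ?_ (old_pair_check hu0 hu (by norm_num) (by norm_num) (by norm_num) hk2r hlor (by norm_num)) hKL hRA hKA hKAtop he0 hea hεt hεrec
  have h2 : (0.5623 : ℝ) ^ 4 * 10 ≤ 1 := by norm_num
  have h1 : (0.5623 : ℝ) ^ 4 * ((k₃ : ℝ) + 1) ≤ (0.5623 : ℝ) ^ 4 * (10 * ((k₂ : ℝ) + 1)) := mul_le_mul_of_nonneg_left hhir (by positivity)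
  have h3 : ((0.5623 : ℝ) ^ 4 * 10) * ((k₂ : ℝ) + 1) ≤ 1 * ((k₂ : ℝ) + 1) := mul_le_mul_of_nonneg_right h2 (by positivity)
  linarith

/-- **RATIO IN `[10, 36]`: `10(k₂+1) ≤ k₃`, `k₃ + 1 ≤ 36(k₂+1)`, `k₂ ≥ 45` ⟹ THE END** ((E92f) with `p₀ = 0.4082`, `u_U = 0.2972`). [folklore] -/
theorem flow_nonneg_census_three_ages_band_10_36 (hmono : ∀ u v : ℕ → ℝ, SeqBox γ u → SeqBox γ v → (∀ j, u j ≤ v j) → B u ≤ B v)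
    (hL : ∀ k, 0 ≤ L k) (hb : 0 < b) (hlo : ∀ u, SeqBox γ u → b ≤ B u) (hdom : ∀ u, SeqBox γ u → ∑ k ∈ range K, L k * u k ≤ B u)
    (hh : SeqBox γ h) (hf : MemFlow B gIR h) (hg : ∀ t, 0 < g t ∧ g t ≤ 1)
    (hgF : ∀ t, 1 ≤ g t * (1 + ∑ k ∈ range K, L k * h (t + k) ^ 3 / 2))
    {k₂ k₃ : ℕ} (hk2 : 45 ≤ k₂) (hlo' : 10 * (k₂ + 1) ≤ k₃) (hhi : k₃ + 1 ≤ 36 * (k₂ + 1)) (hk3K : k₃ < K)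
    (hL3 : ∀ j, j < K → j ≠ 1 → j ≠ k₂ → j ≠ k₃ → L j = 0)
    {N : ℕ} {KL : ℕ → ℕ → ℕ → ℝ}
    (hKL : ∀ k n l, KL k n l = if 0 < k ∧ k < K ∧ l < k then L k * h (n + k) ^ 3 / 2 * ∏ t ∈ Ico (n + 1 + l) (n + k + 1), g t else 0)
    {KA : ℕ → ℕ → ℕ → ℝ} {RA : ℕ → (ℕ → ℝ) → ℕ → ℝ}
    (hRA : ∀ i v m, RA i v m = ∑ l ∈ range K, KA i m l * v (m + 1 + l))
    (hKA : ∀ i m l, KA i m l = KL i m l + KA (i + 1) m l) (hKAtop : ∀ m l, KA K m l = 0)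
    {e ε : ℕ → ℝ} (he0 : ∀ m, 0 ≤ e m) (hea : ∀ m, e (m + 1) ≤ e m)
    (hεt : ∀ m, N < m → ε m = 0) (hεrec : ∀ m, ε m = e m - RA 1 ε m) : ∀ m, 0 ≤ ε m ∧ ε m ≤ e m := by
  have hk2r : (45 : ℝ) ≤ k₂ := by exact_mod_cast hk2
  have hlor : 10 * ((k₂ : ℝ) + 1) ≤ k₃ := by exact_mod_cast hlo'
  have hhir : (k₃ : ℝ) + 1 ≤ 36 * ((k₂ : ℝ) + 1) := by exact_mod_cast hhi
  obtain ⟨hu0, hu⟩ := old_pair_slack_le (p₀ := 0.4082) (uU := 0.2972) (by norm_num) (by norm_num) (by norm_num)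
  refine flow_nonneg_census_three_ages_old_pair hmono hL hb hlo hdom hh hf hg hgF (by omega) (by omega) hk3K hL3 (p₀ := 0.4082) (by norm_num)
    ?_ (old_pair_check hu0 hu (by norm_num) (by norm_num) (by norm_num) hk2r hlor (by norm_num)) hKL hRA hKA hKAtop he0 hea hεt hεrec
  have h2 : (0.4082 : ℝ) ^ 4 * 36 ≤ 1 := by norm_num
  have h1 : (0.4082 : ℝ) ^ 4 * ((k₃ : ℝ) + 1) ≤ (0.4082 : ℝ) ^ 4 * (36 * ((k₂ : ℝ) + 1)) := mul_le_mul_of_nonneg_left hhir (by positivity)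
  have h3 : ((0.4082 : ℝ) ^ 4 * 36) * ((k₂ : ℝ) + 1) ≤ 1 * ((k₂ : ℝ) + 1) := mul_le_mul_of_nonneg_right h2 (by positivity)
  linarith

/-! ## §2 Every old age from `k₂ ≥ 45` -/

/-- **THE CENSUS THREE AGES `{1, k₂, k₃}` WITH `k₂ ≥ 45`: THE END FOR EVERY OLD AGE `k₃ > k₂` — ALONG EVERY ADMISSIBLE FLOW, EVERY HORIZON, EVERY
DAMPING OF THE SELF-CONSISTENT CLASS, NO DISPLAYED MARGIN, WHATEVER THE TOTAL LOAD** (five regimes of the old ratio, §1 and (E92e)∕(E92c)). [folklore] -/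
theorem flow_nonneg_census_three_ages_from_fortyfive (hmono : ∀ u v : ℕ → ℝ, SeqBox γ u → SeqBox γ v → (∀ j, u j ≤ v j) → B u ≤ B v)
    (hL : ∀ k, 0 ≤ L k) (hb : 0 < b) (hlo : ∀ u, SeqBox γ u → b ≤ B u) (hdom : ∀ u, SeqBox γ u → ∑ k ∈ range K, L k * u k ≤ B u)
    (hh : SeqBox γ h) (hf : MemFlow B gIR h) (hg : ∀ t, 0 < g t ∧ g t ≤ 1)
    (hgF : ∀ t, 1 ≤ g t * (1 + ∑ k ∈ range K, L k * h (t + k) ^ 3 / 2))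
    {k₂ k₃ : ℕ} (hk2 : 45 ≤ k₂) (hk23 : k₂ < k₃) (hk3K : k₃ < K) (hL3 : ∀ j, j < K → j ≠ 1 → j ≠ k₂ → j ≠ k₃ → L j = 0)
    {N : ℕ} {KL : ℕ → ℕ → ℕ → ℝ}
    (hKL : ∀ k n l, KL k n l = if 0 < k ∧ k < K ∧ l < k then L k * h (n + k) ^ 3 / 2 * ∏ t ∈ Ico (n + 1 + l) (n + k + 1), g t else 0)
    {KA : ℕ → ℕ → ℕ → ℝ} {RA : ℕ → (ℕ → ℝ) → ℕ → ℝ}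
    (hRA : ∀ i v m, RA i v m = ∑ l ∈ range K, KA i m l * v (m + 1 + l))
    (hKA : ∀ i m l, KA i m l = KL i m l + KA (i + 1) m l) (hKAtop : ∀ m l, KA K m l = 0)
    {e ε : ℕ → ℝ} (he0 : ∀ m, 0 ≤ e m) (hea : ∀ m, e (m + 1) ≤ e m)
    (hεt : ∀ m, N < m → ε m = 0) (hεrec : ∀ m, ε m = e m - RA 1 ε m) : ∀ m, 0 ≤ ε m ∧ ε m ≤ e m := by
  by_cases h2 : k₃ + 1 ≤ 2 * (k₂ + 1)
  · exact flow_nonneg_census_three_ages_ratio_le_two hmono hL hb hlo hdom hh hf hg hgF (by omega) hk23 h2 hk3K hL3 hKL hRA hKA hKAtop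
      he0 hea hεt hεrec
  by_cases h4 : k₃ + 1 ≤ 4 * (k₂ + 1)
  · exact flow_nonneg_census_three_ages_band_2_4 hmono hL hb hlo hdom hh hf hg hgF hk2 (by omega) h4 hk3K hL3 hKL hRA hKA hKAtop
      he0 hea hεt hεrec
  by_cases h10 : k₃ + 1 ≤ 10 * (k₂ + 1)
  · exact flow_nonneg_census_three_ages_band_4_10 hmono hL hb hlo hdom hh hf hg hgF hk2 (by omega) h10 hk3K hL3 hKL hRA hKA hKAtop
      he0 hea hεt hεrec
  by_cases h36 : k₃ + 1 ≤ 36 * (k₂ + 1)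
  · exact flow_nonneg_census_three_ages_band_10_36 hmono hL hb hlo hdom hh hf hg hgF hk2 (by omega) h36 hk3K hL3 hKL hRA hKA hKAtop
      he0 hea hεt hεrec
  -- the tails: k₃ ≥ 36(k₂+1)
  by_cases hA : k₂ ≤ 66
  · exact flow_nonneg_census_three_ages_tail_30_66 hmono hL hb hlo hdom hh hf hg hgF (by omega) hA (by omega) hk3K hL3 hKL hRA hKA hKAtop
      he0 hea hεt hεrec
  by_cases hB : k₂ ≤ 100
  · exact flow_nonneg_census_three_ages_tail_67_100 hmono hL hb hlo hdom hh hf hg hgF (by omega) hB (by omega) hk3K hL3 hKL hRA hKA hKAtop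
      he0 hea hεt hεrec
  by_cases hC : k₂ ≤ 229
  · exact flow_nonneg_census_three_ages_tail_101_229 hmono hL hb hlo hdom hh hf hg hgF (by omega) hC (by omega) hk3K hL3 hKL hRA hKA hKAtop
      he0 hea hεt hεrec
  · exact flow_nonneg_census_three_ages_old_middle hmono hL hb hlo hdom hh hf hg hgF (by omega) hk23 hk3K hL3 hKL hRA hKA hKAtop he0 hea hεt hεrec

/-- **EVERY OLD TAIL OF THE CENSUS THREE AGES: `k₃ ≥ 1600` ⟹ THE END FOR EVERY MIDDLE AGE `k₂ ≥ 2`** — `k₂ ≥ 45`: `flow_nonneg_census_three_ages_from_fortyfive`;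
`14 ≤ k₂ ≤ 44`: the young-pair tails of (E92e); `2 ≤ k₂ ≤ 13`: (E92b)'s discharged wedge R2 with `p₀ = 0.6147` (`0.6147⁴·14 ≤ 2`,
`10·13·1.6147 = 209.9 ≤ (1.6147 − 99∕70)·1600 = 320.7`).  With (E90c) (`k₃ ≤ 56`) the open set of the census three ages lies inside `2 ≤ k₂ ≤ 44`,
`57 ≤ k₃ ≤ 1599`. [folklore] -/
theorem flow_nonneg_census_three_ages_every_tail (hmono : ∀ u v : ℕ → ℝ, SeqBox γ u → SeqBox γ v → (∀ j, u j ≤ v j) → B u ≤ B v)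
    (hL : ∀ k, 0 ≤ L k) (hb : 0 < b) (hlo : ∀ u, SeqBox γ u → b ≤ B u) (hdom : ∀ u, SeqBox γ u → ∑ k ∈ range K, L k * u k ≤ B u)
    (hh : SeqBox γ h) (hf : MemFlow B gIR h) (hg : ∀ t, 0 < g t ∧ g t ≤ 1)
    (hgF : ∀ t, 1 ≤ g t * (1 + ∑ k ∈ range K, L k * h (t + k) ^ 3 / 2))
    {k₂ k₃ : ℕ} (hk2 : 2 ≤ k₂) (hk23 : k₂ < k₃) (hk3 : 1600 ≤ k₃) (hk3K : k₃ < K)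
    (hL3 : ∀ j, j < K → j ≠ 1 → j ≠ k₂ → j ≠ k₃ → L j = 0)
    {N : ℕ} {KL : ℕ → ℕ → ℕ → ℝ}
    (hKL : ∀ k n l, KL k n l = if 0 < k ∧ k < K ∧ l < k then L k * h (n + k) ^ 3 / 2 * ∏ t ∈ Ico (n + 1 + l) (n + k + 1), g t else 0)
    {KA : ℕ → ℕ → ℕ → ℝ} {RA : ℕ → (ℕ → ℝ) → ℕ → ℝ}
    (hRA : ∀ i v m, RA i v m = ∑ l ∈ range K, KA i m l * v (m + 1 + l))
    (hKA : ∀ i m l, KA i m l = KL i m l + KA (i + 1) m l) (hKAtop : ∀ m l, KA K m l = 0)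
    {e ε : ℕ → ℝ} (he0 : ∀ m, 0 ≤ e m) (hea : ∀ m, e (m + 1) ≤ e m)
    (hεt : ∀ m, N < m → ε m = 0) (hεrec : ∀ m, ε m = e m - RA 1 ε m) : ∀ m, 0 ≤ ε m ∧ ε m ≤ e m := by
  by_cases h45 : 45 ≤ k₂
  · exact flow_nonneg_census_three_ages_from_fortyfive hmono hL hb hlo hdom hh hf hg hgF h45 hk23 hk3K hL3 hKL hRA hKA hKAtop he0 hea hεt hεrec
  by_cases h30 : 30 ≤ k₂
  · exact flow_nonneg_census_three_ages_tail_30_66 hmono hL hb hlo hdom hh hf hg hgF h30 (by omega) hk3 hk3K hL3 hKL hRA hKA hKAtop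
      he0 hea hεt hεrec
  by_cases h14 : 14 ≤ k₂
  · exact flow_nonneg_census_three_ages_tail_14_29 hmono hL hb hlo hdom hh hf hg hgF h14 (by omega) (by omega) hk3K hL3 hKL hRA hKA hKAtop
      he0 hea hεt hεrec
  -- 2 ≤ k₂ ≤ 13: wedge R2 discharged
  have hs99 : Real.sqrt 2 ≤ 99 / 70 := Real.sqrt_le_iff.mpr ⟨by norm_num, by norm_num⟩
  have hk2r : (k₂ : ℝ) ≤ 13 := by exact_mod_cast (show k₂ ≤ 13 by omega)
  have hk3r : (1600 : ℝ) ≤ k₃ := by exact_mod_cast hk3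
  refine flow_nonneg_three_ages_young_pair hmono hL hb hlo hdom hh hf hg hgF hk2 hk23 hk3K hL3 (p₀ := 0.6147) (by norm_num) ?_ ?_ hKL hRA hKA hKAtop
    he0 hea hεt hεrec
  · have h1 : (0.6147 : ℝ) ^ 4 * ((k₂ : ℝ) + 1) ≤ (0.6147 : ℝ) ^ 4 * 14 := mul_le_mul_of_nonneg_left (by linarith) (by positivity)
    have h2 : (0.6147 : ℝ) ^ 4 * 14 ≤ 2 := by norm_num
    linarith
  · nlinarith [mul_nonneg (sub_nonneg.2 hs99) (show (0 : ℝ) ≤ (k₃ : ℝ) by positivity)]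

end Summit.QuantumFields.BalabanUV.Beta.EriceRemainderEnclosureHistoryAutonomyComparisonAgeCompositionThreeAgesFromFortyFive

end
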